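import Literature.AlgebraicGeometry.Resolution.EmbeddedResolutionExcellentSurfacesSequence
import Literature.AlgebraicGeometry.Resolution.BlowupSequencesAppend
import Literature.AlgebraicGeometry.Resolution.BlowupsLocal
import Literature.AlgebraicGeometry.Resolution.RegularSubschemeLocallyIrreducible
import HarnessLib

/-!
# Crux `PatchingRelPerfect` (stmt-ResolutionOfSingularities-16161), chain W5.2 — F7(β) (β-AX) X3 C-I (M2b-T), (T-b): REALISATION —
# a Cossart–Jannsen–Saito `𝓑`-permissible sequence is a `CentreSeq` with regular centres over the surface (`…DepthPhaseCContactRealisation`)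

[OURS · L1 W5.2 · F7(β) (β-AX) X3 C-I (M2b-T) · res-L1-w52-plan-1 RULING G12-32 (iii) (assembly input), hand res-D-repro-1 AS res-L1-repro-3]
The named fact F-60 `CossartJannsenSaito2020EmbeddedSequenceBoundary` delivers its blow-up sequence as the inductive predicate
`IsBPermissibleSequenceB X B σ X′ B′` on an ABSTRACT morphism `σ : Z′ ⟶ Z` (each step an abstract blowing up `τ` with `IsBlowup τ C`);
the vehicle of the contact transport ((T-a′) `…DepthPhaseCContactPushforward`, Kollár 3.30.3 push-forward) and the Phase-C targets speak
`CentreSeq` (chosen blow-ups `blowup C`).  This file REALISES the former by the latter: **`exists_centreSeq_of_isBPermissibleSequenceB`** —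
`∃ (t : CentreSeq Z) (e : t.top ≅ Z′), e.hom ≫ σ = t.comp ∧ t.AllRegular ∧ t.CentresOver (closure X)` and `X′ ⊆ σ⁻¹(closure X)` — by
induction on the sequence: each abstract step `τ` along `C ⊇ 𝓘(closure X′)` is the chosen blow-up of the transported centre `C.comap e.hom`
up to the isomorphism of `IsBlowup.unique` (`IsBlowup.comp_iso`), appended on top (`CentreSeq.append` / `comp_append` / `allRegular_append_iff` /
`centresOver_append_iff`); regular centres stay regular along isomorphisms (`isRegular_subscheme_comap_of_isOpenImmersion`), and every centre lies
over `closure X` because the strict transforms do.  Def-free; NOT a statement of the manuscript under review; AI-written, weaker than expert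
review.  Literature files only; no fact (the predicate is Literature΄s, the fact is not assumed here), no sorry.

## References
* V. Cossart, U. Jannsen, S. Saito, *Desingularization: Invariants and Strategy* (LNM 2270, 2020), Def. 6.8 / (6.2), Thm. 6.9 (a). [CossartJannsenSaito2020]
* J. Kollár, *Lectures on Resolution of Singularities* (2007), 3.30.3, 3.109. [Kollar2007]
* U. Görtz, T. Wedhorn, *Algebraic Geometry I* (2020), (13.19) (uniqueness of blow-ups). [GortzWedhorn2020]
-/

-- `Summit.<Summit>.<Sub>.Theorems` with `Sub = Summit` (single-conjunct summit, D-0017)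
set_option linter.dupNamespace false

noncomputable section

open CategoryTheory AlgebraicGeometry TopologicalSpace IsLocalRing
open Literature.AlgebraicGeometry.Resolution
open Scheme.IdealSheafData

namespace Summit.ResolutionOfSingularities.ResolutionOfSingularities.Theorems

namespace ContactRealisation

universe u

/-- The chosen blow-up of the transported centre, followed by the isomorphism, is a blowing up of the centre. [folklore] -/
theorem isBlowup_π_comp_iso {Y Z' : Scheme.{u}} (e : Y ≅ Z') (C : Z'.IdealSheafData) :
    IsBlowup (blowup.π (C.comap e.hom) ≫ e.hom) C := by
  have h1 := (blowup.isBlowup (C.comap e.hom)).comp_iso e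
  rwa [← Scheme.IdealSheafData.comap_comp, Iso.inv_hom_id, Scheme.IdealSheafData.comap_id] at h1

/-- [OURS · L1 W5.2 · (M2b-T) (T-b)] **REALISATION of a `𝓑`-permissible sequence by a centre sequence** (with the strict-transform bound
`X′ ⊆ σ⁻¹(closure X)` carried along): `∃ t e, e.hom ≫ σ = t.comp ∧ t.AllRegular ∧ t.CentresOver (closure X)`.
[cite: CossartJannsenSaito2020, Def. 6.8 / (6.2) (p. 82)] [cite: Kollar2007, 3.109] [cite: GortzWedhorn2020, (13.19) p. 413] -/
theorem exists_centreSeq_of_isBPermissibleSequenceB {Z : Scheme.{u}} {X B : Set Z} {Z' : Scheme.{u}} {σ : Z' ⟶ Z} {X' B' : Set Z'}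
    (h : IsBPermissibleSequenceB X B σ X' B') :
    X' ⊆ σ ⁻¹' closure X ∧
      ∃ (t : CentreSeq Z) (e : t.top ≅ Z'), e.hom ≫ σ = t.comp ∧ t.AllRegular ∧ t.CentresOver (closure X) := by
  induction h with
  | refl => exact ⟨subset_closure, CentreSeq.nil Z, Iso.refl Z, by simp, trivial, trivial⟩
  | @blowup Z' Z'' σ X' B' _ C τ hτ hreg hsub _ _ _ ih =>
    obtain ⟨hX', t, e, he, hreg_t, hover⟩ := ih
    -- the strict transform bound: `closure X′ ⊆ σ⁻¹(closure X)`
    have hcl : closure X' ⊆ σ ⁻¹' closure X := closure_minimal hX' (isClosed_closure.preimage σ.continuous)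
    -- the transported centre on the top of `t`
    have hC'reg : Scheme.IsRegular (C.comap e.hom).subscheme := isRegular_subscheme_comap_of_isOpenImmersion e.hom C hreg
    obtain ⟨f, hf, -⟩ := (isBlowup_π_comp_iso e C).unique hτ
    refine ⟨?_, t.append (CentreSeq.single (C.comap e.hom)), (eqToIso (CentreSeq.top_append t _)).trans f, ?_, ?_, ?_⟩
    · -- the new strict transform lies over `closure X`
      refine closure_minimal (fun z hz => ?_) (isClosed_closure.preimage (τ ≫ σ).continuous)
      show (τ ≫ σ) z ∈ closure X
      rw [Scheme.Hom.comp_apply]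
      exact hX' hz.1
    · -- the equation `e′ ≫ (τ ≫ σ) = (t ⧺ [C′]).comp`
      rw [Iso.trans_hom, eqToIso.hom, Category.assoc, CentreSeq.comp_append, CentreSeq.comp_single, Category.id_comp]
      erw [reassoc_of% hf, he]
      rfl
    · exact (CentreSeq.allRegular_append_iff t _).mpr ⟨hreg_t, hC'reg, trivial⟩
    · refine (CentreSeq.centresOver_append_iff t _ _).mpr ⟨hover, fun y hy => ?_, trivial⟩
      -- `supp (C.comap e.hom) ⊆ t.comp⁻¹(closure X)`: `e y ∈ supp C ⊆ closure X′ ⊆ σ⁻¹(closure X)` and `t.comp = e ≫ σ`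
      rw [Scheme.IdealSheafData.support_comap] at hy
      have h1 : e.hom y ∈ (C.support : Set Z') := hy
      have h2 : e.hom y ∈ closure X' := by
        have h3 := support_antitone hsub h1
        rwa [← SetLike.mem_coe, Scheme.IdealSheafData.coe_support_vanishingIdeal] at h3
      show t.comp y ∈ closure X
      rw [← he, Scheme.Hom.comp_apply]
      exact hcl h2

/-- [OURS · L1 W5.2 · (M2b-T) (T-b)] The realisation for the OUTPUT of F-60 (export shape): a `CentreSeq` with regular centres over
`closure X`, an identification of its top with `Z₁`, and — given `Z₁` regular — a regular top. [cite: CossartJannsenSaito2020, Thm. 1.4 (pp. 5–6)] -/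
theorem exists_centreSeq_of_isBPermissibleSequenceB_of_isRegular {Z : Scheme.{u}} {X B : Set Z} {Z₁ : Scheme.{u}} {π : Z₁ ⟶ Z}
    {X₁ B₁ : Set Z₁} (h : IsBPermissibleSequenceB X B π X₁ B₁) (hZ₁ : Scheme.IsRegular Z₁) :
    ∃ (t : CentreSeq Z) (e : t.top ≅ Z₁), e.hom ≫ π = t.comp ∧ t.AllRegular ∧ t.CentresOver (closure X) ∧
      Scheme.IsRegular t.top ∧ X₁ ⊆ π ⁻¹' closure X := by
  obtain ⟨hX₁, t, e, he, hreg, hover⟩ := exists_centreSeq_of_isBPermissibleSequenceB h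
  exact ⟨t, e, he, hreg, hover, Scheme.IsRegular.of_iso e.inv hZ₁, hX₁⟩

end ContactRealisation

end Summit.ResolutionOfSingularities.ResolutionOfSingularities.Theorems

end
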